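import Summits.HodgeConjecture.HodgeConjecture.Theorems.Q8CommutatorDegreeTwoCoreCayley
import Literature.NumberTheory.DiophantineGeometry.TensorWordModel
import HarnessLib

/-!
# Route `Q8SymplecticPowers`, programme K2Q — brick E-Q part 2a: endomorphisms commuting with the Cayley commutators of the
# quaternionic-unitary centraliser are quaternions (matrix form over `ℂ`), and the `(2,0)`-tensor avatar of an endomorphism

Support file for crux K2Q `PowersHodgeOfQuaternionCommutators` (stmt-HodgeConjecture-24191; `--supports … --as helper`;
nothing here closes an item).  Prover seat `hodge-nonav-20241-p1` (g20).  Pure linear algebra.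

* §1 `tensorPowerMatrix_two_mulVec`: the Kronecker square `M ⊗ M` acts on the tensor `c = vec C` of a matrix `C` by
  `C ↦ M C Mᵀ`; `tensorPowerMatrix_two_mulVec_eq_self_iff`.
* §2 the `G`-orthogonal group is closed under products and inverses; for `M ∈ O(G)`: `M G⁻¹ Mᵀ = G⁻¹`, and
  **`M (P G⁻¹) Mᵀ = P G⁻¹ ↔ M P = P M`** — an endomorphism `P` commutes with `M` iff its `(2,0)`-tensor avatar `P G⁻¹` is
  `M ⊗ M`-invariant (this is how the `(r,0)`-ascent `commutator_invariance_ascends₂` is applied to endomorphisms).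
* §3 **`exists_eq_quaternion_of_commute_cayley_commutators`** (over `ℂ`): for matrices `A, B` with `A² = B² = -1`,
  `AB = -BA`, `G`-orthogonal for a symmetric invertible `G`, every `P` commuting with `g h g⁻¹ h⁻¹` for all Cayley points
  `g, h` (invertible `1 + g`, `1 + h`) of the centraliser-isometry group `Z(A, B) ∩ O(G)` is `α + βA + γB + δAB` — the landed
  ENGINE-CAYLEY `q8Commutator_invariant_bilinForm_eq_of_cayley` (p708176) applied to the form `c(x, y) = G(Px, y)` on `ℂ^N`.

HONEST FRAMING: bookkeeping + linear algebra (axioms standard); item 24191 OPEN; nothing here says HC ∕ HC_CM ∕ HC_AV is proved.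

## References

* R. Goodman, N. Wallach, *Symmetry, Representations, and Invariants*, GTM 255, §1.4.5 Exercise 5 (Cayley parameters),
  §4.2 (double commutant), §5.3.2. [cite: GoodmanWallachGTM255]
* O. T. O'Meara, *Introduction to Quadratic Forms* (1963), §41–§43 (orthogonal groups of forms). [cite: Omeara1963]
-/

set_option linter.dupNamespace false

noncomputable section

open Matrix
open scoped BigOperators

namespace Summit.HodgeConjecture.HodgeConjecture.Theorems.Q8SymplecticPowersEndomorphismMatrix

open Literature.NumberTheory.DiophantineGeometry (tensorPowerMatrix tensorPowerMatrix_apply)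

/-! ### §1 The Kronecker square acts on `vec C` by `C ↦ M C Mᵀ` -/

section Tensor

variable {k : Type*} [Field k] {N : ℕ}

/-- **`(M ⊗ M) · vec C = vec (M C Mᵀ)`** for the Kronecker square `tensorPowerMatrix k N 2 M` acting on the tensor
`w ↦ C (w 0) (w 1)` of a matrix `C`. [cite: GoodmanWallachGTM255, §5.3.2] -/
theorem tensorPowerMatrix_two_mulVec (M C : Matrix (Fin N) (Fin N) k) :
    tensorPowerMatrix k N 2 M *ᵥ (fun w : Fin 2 → Fin N => C (w 0) (w 1)) =
      fun w : Fin 2 → Fin N => (M * C * Mᵀ) (w 0) (w 1) := by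
  funext w
  rw [Matrix.mulVec, dotProduct]
  simp only [tensorPowerMatrix_apply, Fin.prod_univ_two]
  rw [Fintype.sum_equiv (piFinTwoEquiv fun _ => Fin N) _
    (fun ij : Fin N × Fin N => M (w 0) ij.1 * M (w 1) ij.2 * C ij.1 ij.2) (fun w' => by simp),
    Fintype.sum_prod_type, Finset.sum_comm, Matrix.mul_apply]
  refine Finset.sum_congr rfl fun j _ => ?_
  rw [Matrix.mul_apply, Finset.sum_mul, Matrix.transpose_apply]
  exact Finset.sum_congr rfl fun i _ => by ring

/-- **`(M ⊗ M) · vec C = vec C ↔ M C Mᵀ = C`.** [cite: GoodmanWallachGTM255, §5.3.2] -/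
theorem tensorPowerMatrix_two_mulVec_eq_self_iff (M C : Matrix (Fin N) (Fin N) k) :
    tensorPowerMatrix k N 2 M *ᵥ (fun w : Fin 2 → Fin N => C (w 0) (w 1)) =
      (fun w : Fin 2 → Fin N => C (w 0) (w 1)) ↔ M * C * Mᵀ = C := by
  rw [tensorPowerMatrix_two_mulVec]
  refine ⟨fun h => ?_, fun h => by rw [h]⟩
  ext i j
  have hw := congr_fun h ![i, j]
  simpa using hw

end Tensor

/-! ### §2 The `G`-orthogonal group and the `(2,0)`-tensor avatar `P G⁻¹` of an endomorphism `P` -/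

section Orthogonal

variable {k : Type*} [Field k] {n : Type*} [Fintype n] [DecidableEq n]

/-- A `G`-orthogonal matrix is invertible when `G` is. [cite: Omeara1963, §42] -/
theorem isUnit_det_of_orthogonal {G g : Matrix n n k} (hG : IsUnit G.det) (h : gᵀ * G * g = G) : IsUnit g.det := by
  have h1 := congr_arg Matrix.det h
  rw [Matrix.det_mul, Matrix.det_mul, Matrix.det_transpose] at h1
  have h3 : (g.det * g.det - 1) * G.det = 0 := by linear_combination h1
  rcases mul_eq_zero.1 h3 with h4 | h4
  · refine isUnit_iff_ne_zero.2 fun h0 => ?_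
    rw [h0, zero_mul, zero_sub, neg_eq_zero] at h4
    exact one_ne_zero h4
  · exact absurd h4 (isUnit_iff_ne_zero.1 hG)

omit [DecidableEq n] in
/-- `O(G)` is closed under products. [cite: Omeara1963, §42] -/
theorem orthogonal_mul {G g h : Matrix n n k} (hg : gᵀ * G * g = G) (hh : hᵀ * G * h = G) :
    (g * h)ᵀ * G * (g * h) = G := by
  rw [Matrix.transpose_mul, show hᵀ * gᵀ * G * (g * h) = hᵀ * (gᵀ * G * g) * h by
    simp only [Matrix.mul_assoc], hg, hh]

/-- `O(G)` is closed under inverses. [cite: Omeara1963, §42] -/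
theorem orthogonal_inv {G g : Matrix n n k} (hG : IsUnit G.det) (hg : gᵀ * G * g = G) : (g⁻¹)ᵀ * G * g⁻¹ = G := by
  have hgu := isUnit_det_of_orthogonal hG hg
  have hgtu : IsUnit gᵀ.det := by rwa [Matrix.det_transpose]
  calc (g⁻¹)ᵀ * G * g⁻¹ = (gᵀ)⁻¹ * (gᵀ * G * g) * g⁻¹ := by rw [hg, Matrix.transpose_nonsing_inv]
    _ = G := by
      rw [show (gᵀ)⁻¹ * (gᵀ * G * g) * g⁻¹ = ((gᵀ)⁻¹ * gᵀ) * G * (g * g⁻¹) by simp only [Matrix.mul_assoc],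
        Matrix.nonsing_inv_mul _ hgtu, Matrix.mul_nonsing_inv _ hgu, Matrix.one_mul, Matrix.mul_one]

/-- The commutator of two elements of `O(G)` lies in `O(G)`. [cite: Omeara1963, §42] -/
theorem orthogonal_commutator {G g h : Matrix n n k} (hG : IsUnit G.det) (hg : gᵀ * G * g = G) (hh : hᵀ * G * h = G) :
    (g * h * g⁻¹ * h⁻¹)ᵀ * G * (g * h * g⁻¹ * h⁻¹) = G :=
  orthogonal_mul (orthogonal_mul (orthogonal_mul hg hh) (orthogonal_inv hG hg)) (orthogonal_inv hG hh)

/-- The commutator of two elements of `O(G)` is invertible. [cite: Omeara1963, §42] -/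
theorem isUnit_det_commutator {G g h : Matrix n n k} (hG : IsUnit G.det) (hg : gᵀ * G * g = G) (hh : hᵀ * G * h = G) :
    IsUnit (g * h * g⁻¹ * h⁻¹).det :=
  isUnit_det_of_orthogonal hG (orthogonal_commutator hG hg hh)

/-- **`M G⁻¹ Mᵀ = G⁻¹` for `M ∈ O(G)`** (`G⁻¹` is the `(2,0)`-tensor of the form `G`, invariant under its isometries).
[cite: Omeara1963, §42] -/
theorem mul_inv_mul_transpose_eq_inv {G M : Matrix n n k} (hG : IsUnit G.det) (hM : Mᵀ * G * M = G) :
    M * G⁻¹ * Mᵀ = G⁻¹ := by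
  have hMu := isUnit_det_of_orthogonal hG hM
  have h1 : Mᵀ * G = G * M⁻¹ := by
    calc Mᵀ * G = Mᵀ * G * (M * M⁻¹) := by rw [Matrix.mul_nonsing_inv _ hMu, Matrix.mul_one]
      _ = G * M⁻¹ := by rw [← Matrix.mul_assoc, hM]
  refine (Matrix.inv_eq_left_inv ?_).symm
  calc M * G⁻¹ * Mᵀ * G = M * G⁻¹ * (Mᵀ * G) := by simp only [Matrix.mul_assoc]
    _ = 1 := by
      rw [h1, show M * G⁻¹ * (G * M⁻¹) = M * (G⁻¹ * G) * M⁻¹ by simp only [Matrix.mul_assoc],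
        Matrix.nonsing_inv_mul _ hG, Matrix.mul_one, Matrix.mul_nonsing_inv _ hMu]

/-- If `P` commutes with `M ∈ O(G)`, the tensor `P G⁻¹` is `M ⊗ M`-invariant: `M (P G⁻¹) Mᵀ = P G⁻¹`.
[cite: GoodmanWallachGTM255, §5.3.2] -/
theorem mul_mul_transpose_eq_of_commute {G M P : Matrix n n k} (hG : IsUnit G.det) (hM : Mᵀ * G * M = G)
    (hMP : M * P = P * M) : M * (P * G⁻¹) * Mᵀ = P * G⁻¹ := by
  rw [show M * (P * G⁻¹) * Mᵀ = (M * P) * G⁻¹ * Mᵀ by simp only [Matrix.mul_assoc], hMP,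
    show P * M * G⁻¹ * Mᵀ = P * (M * G⁻¹ * Mᵀ) by simp only [Matrix.mul_assoc], mul_inv_mul_transpose_eq_inv hG hM]

/-- Conversely, **if the tensor `P G⁻¹` is `M ⊗ M`-invariant for `M ∈ O(G)`, then `P` commutes with `M`.**
[cite: GoodmanWallachGTM255, §5.3.2] -/
theorem commute_of_mul_mul_transpose_eq {G M P : Matrix n n k} (hG : IsUnit G.det) (hM : Mᵀ * G * M = G)
    (h : M * (P * G⁻¹) * Mᵀ = P * G⁻¹) : M * P = P * M := by
  have hMu := isUnit_det_of_orthogonal hG hM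
  have hMtu : IsUnit Mᵀ.det := by rwa [Matrix.det_transpose]
  have h2 : (M * P) * (G⁻¹ * Mᵀ) = (P * M) * (G⁻¹ * Mᵀ) := by
    rw [show (M * P) * (G⁻¹ * Mᵀ) = M * (P * G⁻¹) * Mᵀ by simp only [Matrix.mul_assoc], h,
      show (P * M) * (G⁻¹ * Mᵀ) = P * (M * G⁻¹ * Mᵀ) by simp only [Matrix.mul_assoc], mul_inv_mul_transpose_eq_inv hG hM]
  have h3 := congr_arg (· * ((Mᵀ)⁻¹ * G)) h2
  rwa [show (M * P) * (G⁻¹ * Mᵀ) * ((Mᵀ)⁻¹ * G) = (M * P) * (G⁻¹ * (Mᵀ * (Mᵀ)⁻¹) * G) by simp only [Matrix.mul_assoc],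
    show (P * M) * (G⁻¹ * Mᵀ) * ((Mᵀ)⁻¹ * G) = (P * M) * (G⁻¹ * (Mᵀ * (Mᵀ)⁻¹) * G) by simp only [Matrix.mul_assoc],
    Matrix.mul_nonsing_inv _ hMtu, Matrix.mul_one, Matrix.nonsing_inv_mul _ hG, Matrix.mul_one, Matrix.mul_one] at h3

end Orthogonal

/-! ### §3 Over `ℂ`: endomorphisms commuting with the Cayley commutators of `Z(A, B) ∩ O(G)` are quaternions -/

section Complex

variable {N : ℕ}

/-- The matrix of a commutator of automorphisms of `k^N` is the commutator of the matrices (standard basis; the argument of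
route A's `CyclicUnitaryPowersDeckUnitaryCayleyAscent.toMatrix_commutator` for `LinearMap.toMatrix'`). [folklore] -/
theorem toMatrix'_commutator {k : Type*} [Field k] (γ δ : (Fin N → k) ≃ₗ[k] (Fin N → k)) :
    LinearMap.toMatrix' ((γ * δ * γ⁻¹ * δ⁻¹ : (Fin N → k) ≃ₗ[k] (Fin N → k)) : (Fin N → k) →ₗ[k] (Fin N → k)) =
      LinearMap.toMatrix' (γ : (Fin N → k) →ₗ[k] (Fin N → k)) * LinearMap.toMatrix' (δ : (Fin N → k) →ₗ[k] (Fin N → k)) *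
        (LinearMap.toMatrix' (γ : (Fin N → k) →ₗ[k] (Fin N → k)))⁻¹ *
          (LinearMap.toMatrix' (δ : (Fin N → k) →ₗ[k] (Fin N → k)))⁻¹ := by
  have hinv : ∀ ε : (Fin N → k) ≃ₗ[k] (Fin N → k), LinearMap.toMatrix' ((ε⁻¹ : (Fin N → k) ≃ₗ[k] (Fin N → k)) :
      (Fin N → k) →ₗ[k] (Fin N → k)) = (LinearMap.toMatrix' (ε : (Fin N → k) →ₗ[k] (Fin N → k)))⁻¹ := by
    intro ε
    refine (Matrix.inv_eq_left_inv ?_).symm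
    rw [← LinearMap.toMatrix'_mul]
    have : ((ε⁻¹ : (Fin N → k) ≃ₗ[k] (Fin N → k)) : (Fin N → k) →ₗ[k] (Fin N → k)) * (ε : (Fin N → k) →ₗ[k] (Fin N → k)) =
        1 := by
      ext x; simp
    rw [this, show (1 : (Fin N → k) →ₗ[k] (Fin N → k)) = LinearMap.id from rfl, LinearMap.toMatrix'_id]
  have hmul : ∀ ε ε' : (Fin N → k) ≃ₗ[k] (Fin N → k), LinearMap.toMatrix' ((ε * ε' : (Fin N → k) ≃ₗ[k] (Fin N → k)) :
      (Fin N → k) →ₗ[k] (Fin N → k)) =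
      LinearMap.toMatrix' (ε : (Fin N → k) →ₗ[k] (Fin N → k)) * LinearMap.toMatrix' (ε' : (Fin N → k) →ₗ[k] (Fin N → k)) := by
    intro ε ε'
    rw [← LinearMap.toMatrix'_mul]
    rfl
  rw [hmul, hmul, hmul, hinv, hinv]

/-- `Aᵀ G = -(G A)` for a `G`-orthogonal `A` with `A² = -1`. [cite: Omeara1963, §42] -/
theorem transpose_mul_eq_neg {k : Type*} [Field k] {A G : Matrix (Fin N) (Fin N) k} (hA : A * A = -1)
    (hAG : Aᵀ * G * A = G) : Aᵀ * G = -(G * A) := by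
  have h := congr_arg (· * A) hAG
  rw [Matrix.mul_assoc, hA, Matrix.mul_neg, Matrix.mul_one] at h
  rw [← neg_neg (Aᵀ * G), h]

/-- **Endomorphisms commuting with the Cayley commutators of the quaternionic-unitary centraliser are quaternions** (matrix
form over `ℂ`).  For `A, B ∈ M_N(ℂ)` with `A² = B² = -1`, `AB = -BA`, both `G`-orthogonal for a symmetric invertible `G`:
if `P` commutes with `g h g⁻¹ h⁻¹` for all `g, h ∈ Z(A, B) ∩ O(G)` with `1 + g`, `1 + h` invertible, then
`P = α + βA + γB + δAB`.  The form `c(x, y) = G(Px, y)` on `ℂ^N` is invariant under those commutators, so ENGINE-CAYLEY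
(`q8Commutator_invariant_bilinForm_eq_of_cayley`) writes it as `αG(x,y) + βG(x,Ay) + γG(x,By) + δG(x,ABy)`; transpose with
`Aᵀ G = -G A`, `Bᵀ G = -G B`. [cite: GoodmanWallachGTM255, §4.2 and §1.4.5 Exercise 5] [cite: Omeara1963, §43] -/
theorem exists_eq_quaternion_of_commute_cayley_commutators (A B G P : Matrix (Fin N) (Fin N) ℂ)
    (hA : A * A = -1) (hB : B * B = -1) (hAB : A * B = -(B * A))
    (hAG : Aᵀ * G * A = G) (hBG : Bᵀ * G * B = G) (hGt : Gᵀ = G) (hG : IsUnit G.det)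
    (hP : ∀ g h : Matrix (Fin N) (Fin N) ℂ, IsUnit (1 + g).det → IsUnit (1 + h).det →
      g * A = A * g → h * A = A * h → g * B = B * g → h * B = B * h → gᵀ * G * g = G → hᵀ * G * h = G →
      g * h * g⁻¹ * h⁻¹ * P = P * (g * h * g⁻¹ * h⁻¹)) :
    ∃ α β γ δ : ℂ, P = α • 1 + β • A + γ • B + δ • (A * B) := by
  -- the data of ENGINE-CAYLEY on `V = ℂ^N`
  let Q : LinearMap.BilinForm ℂ (Fin N → ℂ) := Matrix.toBilin' G
  let a : (Fin N → ℂ) →ₗ[ℂ] (Fin N → ℂ) := Matrix.toLin' A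
  let b : (Fin N → ℂ) →ₗ[ℂ] (Fin N → ℂ) := Matrix.toLin' B
  let c : LinearMap.BilinForm ℂ (Fin N → ℂ) := Matrix.toBilin' (Pᵀ * G)
  have hQ : ∀ x y, Q x y = x ⬝ᵥ (G *ᵥ y) := fun x y => Matrix.toBilin'_apply' G x y
  have hQs : ∀ x y, Q x y = Q y x := fun x y => by
    rw [hQ, hQ, Matrix.dotProduct_mulVec, dotProduct_comm, ← Matrix.mulVec_transpose, hGt]
  have hQn : Q.Nondegenerate :=
    (Matrix.nondegenerate_toBilin'_iff (M := G)).2 (Matrix.nondegenerate_of_det_ne_zero (isUnit_iff_ne_zero.1 hG))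
  have ha : ∀ x, a x = A *ᵥ x := fun x => Matrix.toLin'_apply A x
  have hb : ∀ x, b x = B *ᵥ x := fun x => Matrix.toLin'_apply B x
  have haa : ∀ x, a (a x) = -x := fun x => by rw [ha, ha, Matrix.mulVec_mulVec, hA, Matrix.neg_mulVec, Matrix.one_mulVec]
  have hbb : ∀ x, b (b x) = -x := fun x => by rw [hb, hb, Matrix.mulVec_mulVec, hB, Matrix.neg_mulVec, Matrix.one_mulVec]
  have hab : ∀ x, a (b x) = -b (a x) := fun x => by
    rw [ha, hb, ha, hb, Matrix.mulVec_mulVec, Matrix.mulVec_mulVec, hAB, Matrix.neg_mulVec]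
  have hcompQ : ∀ (S : Matrix (Fin N) (Fin N) ℂ), Sᵀ * G * S = G →
      ∀ x y, Q (Matrix.toLin' S x) (Matrix.toLin' S y) = Q x y := by
    intro S hS x y
    have h := Matrix.toBilin'_comp G S S
    rw [hS] at h
    have h' := congr_arg (fun D : LinearMap.BilinForm ℂ (Fin N → ℂ) => D x y) h
    simpa only [LinearMap.BilinForm.comp_apply] using h'
  have haQ : ∀ x y, Q (a x) (a y) = Q x y := hcompQ A hAG
  have hbQ : ∀ x y, Q (b x) (b y) = Q x y := hcompQ B hBG
  have hc : ∀ x y, c x y = Q (Matrix.toLin' P x) y := fun x y => by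
    change Matrix.toBilin' (Pᵀ * G) x y = Matrix.toBilin' G (Matrix.toLin' P x) y
    rw [Matrix.toBilin'_apply', Matrix.toBilin'_apply', Matrix.toLin'_apply, ← Matrix.mulVec_mulVec,
      Matrix.dotProduct_mulVec, ← Matrix.mulVec_transpose, Matrix.transpose_transpose]
  -- invariance of `c` under the Cayley commutators
  have hcinv : ∀ g h : (Fin N → ℂ) ≃ₗ[ℂ] (Fin N → ℂ), (∀ x, g (a x) = a (g x)) → (∀ x, g (b x) = b (g x)) →
      (∀ x y, Q (g x) (g y) = Q x y) → (∀ x, h (a x) = a (h x)) → (∀ x, h (b x) = b (h x)) →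
      (∀ x y, Q (h x) (h y) = Q x y) →
      IsUnit (LinearMap.det ((g : (Fin N → ℂ) →ₗ[ℂ] (Fin N → ℂ)) + 1)) →
      IsUnit (LinearMap.det ((h : (Fin N → ℂ) →ₗ[ℂ] (Fin N → ℂ)) + 1)) →
      ∀ x y, c ((g * h * g⁻¹ * h⁻¹) x) ((g * h * g⁻¹ * h⁻¹) y) = c x y := by
    intro g h hga hgb hgQ hha hhb hhQ hg1 hh1 x y
    -- matrices of `g`, `h`
    have comm : ∀ (e : (Fin N → ℂ) ≃ₗ[ℂ] (Fin N → ℂ)) (S : Matrix (Fin N) (Fin N) ℂ),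
        (∀ x, e (Matrix.toLin' S x) = Matrix.toLin' S (e x)) →
        LinearMap.toMatrix' (e : (Fin N → ℂ) →ₗ[ℂ] (Fin N → ℂ)) * S = S * LinearMap.toMatrix' (e : _ →ₗ[ℂ] _) := by
      intro e S he
      have hcomp : (e : (Fin N → ℂ) →ₗ[ℂ] (Fin N → ℂ)) ∘ₗ Matrix.toLin' S = Matrix.toLin' S ∘ₗ (e : _ →ₗ[ℂ] _) :=
        LinearMap.ext he
      have := congr_arg LinearMap.toMatrix' hcomp
      rwa [LinearMap.toMatrix'_comp, LinearMap.toMatrix'_comp, LinearMap.toMatrix'_toLin'] at this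
    have isom : ∀ (e : (Fin N → ℂ) ≃ₗ[ℂ] (Fin N → ℂ)), (∀ x y, Q (e x) (e y) = Q x y) →
        (LinearMap.toMatrix' (e : (Fin N → ℂ) →ₗ[ℂ] (Fin N → ℂ)))ᵀ * G * LinearMap.toMatrix' (e : _ →ₗ[ℂ] _) = G := by
      intro e he
      have hcomp : Q.comp (e : (Fin N → ℂ) →ₗ[ℂ] (Fin N → ℂ)) (e : _ →ₗ[ℂ] _) = Q :=
        LinearMap.ext fun x => LinearMap.ext fun y => he x y
      have := congr_arg LinearMap.BilinForm.toMatrix' hcomp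
      rwa [LinearMap.BilinForm.toMatrix'_comp, show LinearMap.BilinForm.toMatrix' Q = G from
        LinearMap.BilinForm.toMatrix'_toBilin' G] at this
    have cayley : ∀ (e : (Fin N → ℂ) ≃ₗ[ℂ] (Fin N → ℂ)), IsUnit (LinearMap.det ((e : (Fin N → ℂ) →ₗ[ℂ] (Fin N → ℂ)) + 1)) →
        IsUnit (1 + LinearMap.toMatrix' (e : (Fin N → ℂ) →ₗ[ℂ] (Fin N → ℂ))).det := by
      intro e he
      rwa [← LinearMap.det_toMatrix', map_add, show (1 : (Fin N → ℂ) →ₗ[ℂ] (Fin N → ℂ)) = LinearMap.id from rfl,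
        LinearMap.toMatrix'_id, add_comm] at he
    set γ := LinearMap.toMatrix' (g : (Fin N → ℂ) →ₗ[ℂ] (Fin N → ℂ)) with hγ
    set δ := LinearMap.toMatrix' (h : (Fin N → ℂ) →ₗ[ℂ] (Fin N → ℂ)) with hδ
    have hγG := isom g hgQ
    have hδG := isom h hhQ
    have hM := hP γ δ (cayley g hg1) (cayley h hh1) (comm g A hga) (comm h A hha) (comm g B hgb) (comm h B hhb) hγG hδG
    -- the commutator acts by the matrix `γ δ γ⁻¹ δ⁻¹`
    have hK : ((g * h * g⁻¹ * h⁻¹ : (Fin N → ℂ) ≃ₗ[ℂ] (Fin N → ℂ)) : (Fin N → ℂ) →ₗ[ℂ] (Fin N → ℂ)) =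
        Matrix.toLin' (γ * δ * γ⁻¹ * δ⁻¹) := by
      rw [hγ, hδ, ← toMatrix'_commutator, Matrix.toLin'_toMatrix']
    have hMO := orthogonal_commutator hG hγG hδG
    have hKx : ∀ z, (g * h * g⁻¹ * h⁻¹) z = Matrix.toLin' (γ * δ * γ⁻¹ * δ⁻¹) z := fun z => by
      rw [← hK, LinearEquiv.coe_coe]
    have hPM : ∀ z, Matrix.toLin' P (Matrix.toLin' (γ * δ * γ⁻¹ * δ⁻¹) z) =
        Matrix.toLin' (γ * δ * γ⁻¹ * δ⁻¹) (Matrix.toLin' P z) := fun z => by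
      rw [← LinearMap.comp_apply (Matrix.toLin' P), ← Matrix.toLin'_mul, ← hM, Matrix.toLin'_mul, LinearMap.comp_apply]
    rw [hKx, hKx, hc, hc, hPM, hcompQ _ hMO]
  -- ENGINE-CAYLEY
  obtain ⟨α, β, γ, δ, hαβγδ⟩ := Q8CommutatorDegreeTwoCoreCayley.q8Commutator_invariant_bilinForm_eq_of_cayley hQs hQn a b
    haa hbb hab haQ hbQ Complex.I_mul_I c hcinv
  -- read the identity of forms as `Pᵀ G = α G + β G A + γ G B + δ G A B`
  have hforms : c = α • Q + β • Q.compRight a + γ • Q.compRight b + δ • Q.compRight (a ∘ₗ b) := by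
    refine LinearMap.ext fun x => LinearMap.ext fun y => ?_
    rw [hαβγδ x y]
    simp only [LinearMap.add_apply, LinearMap.smul_apply, LinearMap.BilinForm.compRight_apply, LinearMap.comp_apply,
      smul_eq_mul]
  have hmat : Pᵀ * G = α • G + β • (G * A) + γ • (G * B) + δ • (G * (A * B)) := by
    have h := congr_arg LinearMap.BilinForm.toMatrix' hforms
    rw [show LinearMap.BilinForm.toMatrix' c = Pᵀ * G from LinearMap.BilinForm.toMatrix'_toBilin' _] at h
    rw [h]
    simp only [a, b, Q, map_add, map_smul, LinearMap.BilinForm.toMatrix'_compRight, LinearMap.toMatrix'_toLin',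
      LinearMap.toMatrix'_comp, LinearMap.BilinForm.toMatrix'_toBilin']
  -- transpose: `G P = G (α - β A - γ B - δ A B)`
  have hAt := transpose_mul_eq_neg hA hAG
  have hBt := transpose_mul_eq_neg hB hBG
  have hGP : G * P = G * (α • 1 + (-β) • A + (-γ) • B + (-δ) • (A * B)) := by
    have h := congr_arg Matrix.transpose hmat
    rw [Matrix.transpose_mul, Matrix.transpose_transpose, hGt] at h
    rw [h]
    simp only [Matrix.transpose_add, Matrix.transpose_smul, Matrix.transpose_mul, hGt, Matrix.mul_add, Matrix.mul_smul,
      Matrix.mul_one]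
    rw [hAt, hBt, Matrix.mul_assoc Bᵀ Aᵀ G, hAt, Matrix.mul_neg, ← Matrix.mul_assoc Bᵀ G A, hBt, Matrix.neg_mul, neg_neg,
      Matrix.mul_assoc G B A, show B * A = -(A * B) by rw [hAB, neg_neg], Matrix.mul_neg]
    simp only [smul_neg, neg_smul]
  refine ⟨α, -β, -γ, -δ, ?_⟩
  have h := congr_arg (G⁻¹ * ·) hGP
  rwa [← Matrix.mul_assoc, ← Matrix.mul_assoc, Matrix.nonsing_inv_mul _ hG, Matrix.one_mul, Matrix.one_mul] at h

end Complex

end Summit.HodgeConjecture.HodgeConjecture.Theorems.Q8SymplecticPowersEndomorphismMatrix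

end
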